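import Literature.AlgebraicGeometry.Resolution.TaylorOrderBound
import Literature.AlgebraicGeometry.Resolution.DifferentialOperators
import Literature.AlgebraicGeometry.Resolution.OriginLocalRing
import Mathlib.RingTheory.MvPowerSeries.NoZeroDivisors
import Mathlib.RingTheory.LocalRing.ResidueField.Basic
import HarnessLib

/-!
# The unit form of the order criterion at the origin of affine space (every characteristic)

Topic: `Literature/AlgebraicGeometry/Resolution`. Let `k` be a field (any characteristic),
`S = k[x₁,…,xₙ]_{(x)}` (`OriginLocalization k n`), `𝔪` its maximal ideal, `g ∈ 𝔪^m ∖ 𝔪^{m+1}`. Then for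
every `e` some `k`-linear differential operator of `S` of order `≤ em` (Grothendieck's sense, the tree's
`IsDiffOpLE`) takes `g^e` to a UNIT; equivalently `Diff^{≤ em}_{S/k}((g^e)) = S`
(`OriginLocalization.diffIdeal_span_singleton_pow_eq_top`). The operator is a Hasse–Schmidt component `D^{[δ]}`, `|δ| = em`,
of the Taylor homomorphism `τ̂ : S → S⟦Y⟧` (`x ↦ x + Y` through the localisation, as in
`TaylorOrderBound.lean`). Ingredients: (1) the components of ANY Hasse–Schmidt homomorphism
`φ : B → B⟦Y⟧` sending a base ring `R` to constants are differential operators of order `≤ |β|` over `R`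
(`isDiffOpLE_hsComponentₗ`; EGA IV₄ 16.11.2 in the polynomial case); (2) for `g = f/s`, a least-degree
monomial `x^β` of `f` has `|β| = m` and `D^{[β]} g ≡ coeff_β(f)/s (mod 𝔪)` is a unit, the components of
degree `< m` vanishing mod `𝔪` by `hsComponent_mem_pow` — so `τ̂(g) mod 𝔪 ∈ κ⟦Y⟧` has order `m`;
(3) `κ⟦Y⟧` is a domain (`MvPowerSeries.order_mul`), so `τ̂(g^e) mod 𝔪` has order `em`.
The tree already has the polynomial-level criterion (`diffIdeal_le_idealOfVars_iff`,
`HasseSchmidtDerivatives.lean`) and the non-membership half at every prime (`TaylorOrderBound.lean`); new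
here are the local ring, the powers, and (1).

Used by the Hironaka-2017 adjudication cell (`res-hironaka`, GAP-LEDGER R37/R01) as the MODEL CASE of the
clause «`Diff^{(md′−md)} g^{d′−d} = O_{Z,ξ}` by the assumption on `g`» (p.27 l.24, typed
`Hironaka2017.S05NegativePart.U27L24`); nothing about the manuscript is asserted here.

Sources: [EGAIV4] §16.8, Thm. 16.11.2; [VillamayorU2008ReesDiff] §4.1, Remark 4.3; [Matsumura1987] §27.
-/

noncomputable section

namespace Literature.AlgebraicGeometry.Resolution

open Finsupp IsLocalRing

/-! ## Components of a Hasse–Schmidt homomorphism are differential operators -/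

section HSDiffOp

variable {R : Type*} {B : Type*} [CommRing R] [CommRing B] [Algebra R B] {σ : Type*}

/-- The `β`-component of a Hasse–Schmidt homomorphism `φ : B → B⟦Y⟧` which maps the base ring `R` to
constants (`φ (r·1) = r·1`), as an `R`-LINEAR endomorphism of `B`. [cite: Matsumura1987, §27] -/
def hsComponentₗ (φ : B →+* MvPowerSeries σ B)
    (hφR : ∀ r : R, φ (algebraMap R B r) = MvPowerSeries.C (algebraMap R B r)) (β : σ →₀ ℕ) :
    B →ₗ[R] B where
  toFun := hsComponent φ β
  map_add' := hsComponent_add φ β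
  map_smul' r b := by
    simp only [hsComponent, Algebra.smul_def, map_mul, hφR, RingHom.id_apply]
    rw [MvPowerSeries.coeff_C_mul]

/-- The underlying function of `hsComponentₗ` is `hsComponent`. [folklore] -/
@[simp] private theorem hsComponentₗ_apply (φ : B →+* MvPowerSeries σ B)
    (hφR : ∀ r : R, φ (algebraMap R B r) = MvPowerSeries.C (algebraMap R B r)) (β : σ →₀ ℕ) (b : B) :
    hsComponentₗ φ hφR β b = hsComponent φ β b :=
  rfl

/-- **The commutator of a component with a multiplication** is a combination of LOWER components:
`[D^{[β]}, a] = Σ_{γ+δ=β, γ≠0} D^{[γ]}(a) • D^{[δ]}` (Leibniz rule minus its `γ = 0` term), when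
`constantCoeff ∘ φ = id`. [cite: EGAIV4, Prop. 16.8.8 (b)] -/
theorem commMul_hsComponentₗ [DecidableEq σ] (φ : B →+* MvPowerSeries σ B)
    (hφR : ∀ r : R, φ (algebraMap R B r) = MvPowerSeries.C (algebraMap R B r))
    (hφ : ∀ b, MvPowerSeries.constantCoeff (φ b) = b) (β : σ →₀ ℕ) (a : B) :
    commMul R (hsComponentₗ φ hφR β) a =
      ∑ p ∈ (Finset.antidiagonal β).erase (0, β), hsComponent φ p.1 a • hsComponentₗ φ hφR p.2 := by
  refine LinearMap.ext fun t => ?_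
  have h0 : ((0 : σ →₀ ℕ), β) ∈ Finset.antidiagonal β := by simp
  rw [commMul_apply, hsComponentₗ_apply, hsComponent_mul, ← Finset.add_sum_erase _ _ h0,
    LinearMap.sum_apply]
  simp only [hsComponent_zero φ hφ, hsComponentₗ_apply, LinearMap.smul_apply, smul_eq_mul]
  ring

/-- **Components of a Hasse–Schmidt homomorphism are differential operators of order `≤ |β|`**
(relative to any base ring mapped to constants), in every characteristic: by induction on `|β|`,
`[D^{[β]}, a]` is a combination of components of strictly smaller degree.
[cite: EGAIV4, Thm. 16.11.2 (the D_p are differential operators of order ≤ |p|)] -/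
theorem isDiffOpLE_hsComponentₗ [DecidableEq σ] (φ : B →+* MvPowerSeries σ B)
    (hφR : ∀ r : R, φ (algebraMap R B r) = MvPowerSeries.C (algebraMap R B r))
    (hφ : ∀ b, MvPowerSeries.constantCoeff (φ b) = b) :
    ∀ (n : ℕ) (β : σ →₀ ℕ), degree β ≤ n → IsDiffOpLE R n (hsComponentₗ φ hφR β)
  | 0, β, hβ => by
    have hβ0 : β = 0 := by
      rw [← degree_eq_zero_iff]; omega
    subst hβ0
    intro a
    refine LinearMap.ext fun t => ?_
    simp only [commMul_apply, hsComponentₗ_apply, hsComponent_zero φ hφ, LinearMap.zero_apply]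
    ring
  | n + 1, β, hβ => fun a => by
    rw [commMul_hsComponentₗ φ hφR hφ]
    refine IsDiffOpLE.sum _ fun p hp => IsDiffOpLE.smul _ (isDiffOpLE_hsComponentₗ φ hφR hφ n p.2 ?_)
    obtain ⟨hne, hp'⟩ := Finset.mem_erase.mp hp
    rw [Finset.mem_antidiagonal] at hp'
    have h1 : p.1 ≠ 0 := by
      intro h1
      apply hne
      rw [h1, zero_add] at hp'
      exact Prod.ext h1 hp'
    have hdeg : degree p.1 + degree p.2 = degree β := by rw [← map_add, hp']
    have h1' : 1 ≤ degree p.1 := by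
      rw [Nat.one_le_iff_ne_zero, Ne, degree_eq_zero_iff]; exact h1
    omega

end HSDiffOp

/-! ## The Taylor homomorphism of `k[x]_{(x)}` and its components -/

section Origin

open Literature.NumberTheory.Transcendental _root_.MvPolynomial

universe u

variable (k : Type u) [Field k] (n : ℕ)

namespace OriginLocalization

/-- The Taylor homomorphism on polynomials with coefficients pushed to the local ring:
`f ↦ Σ_β D^{[β]}(f) Y^β ∈ S⟦Y⟧`, `S = k[x]_{(x)}` (`x ↦ x + Y`). [cite: Matsumura1987, §27] -/
def taylorHSPoly :
    MvPolynomial (Fin n) k →+* MvPowerSeries (Fin n) (OriginLocalization k n) :=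
  (MvPowerSeries.map (algebraMap (MvPolynomial (Fin n) k) (OriginLocalization k n))).comp
    ((MvPolynomial.coeToMvPowerSeries.ringHom).comp
      (Taylor.shift : MvPolynomial (Fin n) k →ₐ[k] _).toRingHom)

/-- Its coefficients are the Hasse–Schmidt derivatives `taylorCoeff β f`, read in `S`.
[cite: Matsumura1987, §27 (higher derivations)] -/
theorem coeff_taylorHSPoly (f : MvPolynomial (Fin n) k) (β : Fin n →₀ ℕ) :
    MvPowerSeries.coeff β (taylorHSPoly k n f) =
      algebraMap (MvPolynomial (Fin n) k) (OriginLocalization k n) (Taylor.taylorCoeff β f) := by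
  change MvPowerSeries.coeff β (MvPowerSeries.map (algebraMap _ (OriginLocalization k n))
    (↑(Taylor.shift f) : MvPowerSeries (Fin n) (MvPolynomial (Fin n) k))) = _
  rw [MvPowerSeries.coeff_map, MvPolynomial.coeff_coe]
  rfl

/-- Its constant term is `f` itself (`D^{[0]} = id`). [cite: Matsumura1987, §27 (higher derivations, D_0 = id)] -/
theorem constantCoeff_taylorHSPoly (f : MvPolynomial (Fin n) k) :
    MvPowerSeries.constantCoeff (taylorHSPoly k n f) =
      algebraMap (MvPolynomial (Fin n) k) (OriginLocalization k n) f := by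
  rw [← MvPowerSeries.coeff_zero_eq_constantCoeff_apply, coeff_taylorHSPoly,
    Taylor.taylorCoeff_zero_index]

/-- Scalars go to constants: `τ(c) = c`. [folklore] -/
private theorem taylorHSPoly_C (c : k) :
    taylorHSPoly k n (C c) =
      MvPowerSeries.C (algebraMap (MvPolynomial (Fin n) k) (OriginLocalization k n) (C c)) := by
  change MvPowerSeries.map (algebraMap _ (OriginLocalization k n))
    (↑(Taylor.shift (C c : MvPolynomial (Fin n) k)) : MvPowerSeries (Fin n) (MvPolynomial (Fin n) k)) = _
  rw [Taylor.shift_C, MvPolynomial.coe_C, MvPowerSeries.map_C]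

/-- Polynomials non-vanishing at the origin become units of `S⟦Y⟧` under `τ`. [folklore] -/
private theorem isUnit_taylorHSPoly (s : (originIdeal k n).primeCompl) :
    IsUnit (taylorHSPoly k n (s : MvPolynomial (Fin n) k)) :=
  MvPowerSeries.isUnit_iff_constantCoeff.mpr (by
    rw [constantCoeff_taylorHSPoly]
    exact IsLocalization.map_units (OriginLocalization k n) s)

/-- **The Taylor homomorphism `τ̂ : S → S⟦Y⟧` of `S = k[x]_{(x)}`** (`x ↦ x + Y`, extended through the
localisation). [cite: Matsumura1987, §27 (extension of higher derivations to localisations)] -/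
def taylorHS : OriginLocalization k n →+* MvPowerSeries (Fin n) (OriginLocalization k n) :=
  IsLocalization.lift (M := (originIdeal k n).primeCompl) (isUnit_taylorHSPoly k n)

/-- `τ̂` extends `τ`. [cite: Matsumura1987, §27 (extension of higher derivations to localisations)] -/
theorem taylorHS_algebraMap (f : MvPolynomial (Fin n) k) :
    taylorHS k n (algebraMap (MvPolynomial (Fin n) k) (OriginLocalization k n) f) =
      taylorHSPoly k n f :=
  IsLocalization.lift_eq (isUnit_taylorHSPoly k n) f

/-- `constantCoeff ∘ τ̂ = id` (a Hasse–Schmidt homomorphism). [cite: Matsumura1987, §27] -/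
theorem constantCoeff_taylorHS (z : OriginLocalization k n) :
    MvPowerSeries.constantCoeff (taylorHS k n z) = z := by
  have : MvPowerSeries.constantCoeff.comp (taylorHS k n) = RingHom.id _ := by
    refine IsLocalization.ringHom_ext (originIdeal k n).primeCompl (RingHom.ext fun a => ?_)
    simp only [RingHom.comp_apply, RingHom.id_apply]
    rw [taylorHS_algebraMap, constantCoeff_taylorHSPoly]
  exact RingHom.congr_fun this z

/-- `τ̂` maps the scalars `k` to constants (the extension is a higher `k`-derivation).
[cite: Matsumura1987, §27 (extension of higher derivations to localisations)] -/
theorem taylorHS_algebraMap_base (c : k) :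
    taylorHS k n (algebraMap k (OriginLocalization k n) c) =
      MvPowerSeries.C (algebraMap k (OriginLocalization k n) c) := by
  rw [IsScalarTower.algebraMap_apply k (MvPolynomial (Fin n) k) (OriginLocalization k n),
    MvPolynomial.algebraMap_eq, taylorHS_algebraMap, taylorHSPoly_C]

/-- **The Hasse–Schmidt operators `D^{[β]}` of `S = k[x]_{(x)}`** (components of `τ̂`), as `k`-linear
endomorphisms. [cite: EGAIV4, Thm. 16.11.2] -/
abbrev hsOp (β : Fin n →₀ ℕ) : OriginLocalization k n →ₗ[k] OriginLocalization k n :=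
  hsComponentₗ (taylorHS k n) (taylorHS_algebraMap_base k n) β

/-- `D^{[β]}` is a differential operator of order `≤ |β|` on `S`, relative to `k`. [cite: EGAIV4, Thm. 16.11.2] -/
theorem isDiffOpLE_hsOp (β : Fin n →₀ ℕ) : IsDiffOpLE k (degree β) (hsOp k n β) :=
  isDiffOpLE_hsComponentₗ _ _ (constantCoeff_taylorHS k n) _ β le_rfl

/-- On polynomials `D^{[β]}` is the Hasse–Schmidt derivative `taylorCoeff β`.
[cite: Matsumura1987, §27 (extension of higher derivations to localisations)] -/
theorem hsComponent_taylorHS_algebraMap (β : Fin n →₀ ℕ) (f : MvPolynomial (Fin n) k) :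
    hsComponent (taylorHS k n) β (algebraMap (MvPolynomial (Fin n) k) (OriginLocalization k n) f) =
      algebraMap (MvPolynomial (Fin n) k) (OriginLocalization k n) (Taylor.taylorCoeff β f) := by
  rw [hsComponent, taylorHS_algebraMap, coeff_taylorHSPoly]

/-- `D^{[β]}` lowers the `𝔪`-adic order by at most `|β|`. [cite: Matsumura1987, §27] -/
theorem hsComponent_taylorHS_mem_pow (β : Fin n →₀ ℕ) {e : ℕ} {z : OriginLocalization k n}
    (hz : z ∈ maximalIdeal (OriginLocalization k n) ^ e) :
    hsComponent (taylorHS k n) β z ∈ maximalIdeal (OriginLocalization k n) ^ (e - degree β) :=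
  hsComponent_mem_pow _ (constantCoeff_taylorHS k n) _ e β hz

/-- The value of `D^{[β]} f` at the origin is the coefficient of `x^β` in `f` (`f(0+u) = Σ coeff_β(f) u^β`).
[cite: VillamayorU2008ReesDiff, §4.1 (proof: check at the local ring / power series)] -/
theorem constantCoeff_taylorCoeff (β : Fin n →₀ ℕ) (f : MvPolynomial (Fin n) k) :
    constantCoeff (Taylor.taylorCoeff β f) = coeff β f := by
  have := congrArg (MvPolynomial.coeff β) (Taylor.map_constantCoeff_shift f)
  rw [MvPolynomial.coeff_map] at this
  rw [← this]
  rfl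

/-- Membership of a polynomial in a power of the maximal ideal of `S` is membership in the power of
the ideal of the origin (the latter being maximal). [folklore] -/
private theorem algebraMap_mem_maximalIdeal_pow_iff (f : MvPolynomial (Fin n) k) (e : ℕ) :
    algebraMap (MvPolynomial (Fin n) k) (OriginLocalization k n) f ∈
        maximalIdeal (OriginLocalization k n) ^ e ↔ f ∈ originIdeal k n ^ e := by
  rw [← Ideal.mem_comap]
  change f ∈ (maximalIdeal (OriginLocalization k n) ^ e).under _ ↔ _
  rw [IsLocalization.AtPrime.under_maximalIdeal_pow (originIdeal k n) (OriginLocalization k n) e]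

/-- `f ∈ (x)^e` iff all coefficients of degree `< e` vanish (Mathlib `mem_pow_idealOfVars_iff'`). [folklore] -/
private theorem mem_originIdeal_pow_iff (f : MvPolynomial (Fin n) k) (e : ℕ) :
    f ∈ originIdeal k n ^ e ↔ ∀ β : Fin n →₀ ℕ, degree β < e → coeff β f = 0 := by
  rw [originIdeal_eq_span]
  exact mem_pow_idealOfVars_iff' e f

/-- **Order exactly `m` ⇒ a Hasse–Schmidt derivative of order `m` is a unit.** If `g ∈ 𝔪^m` and
`g ∉ 𝔪^{m+1}` in `S = k[x]_{(x)}`, then `D^{[β]} g` is a unit of `S` for some `|β| = m`.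
[cite: VillamayorU2008ReesDiff, §4.1 and Remark 4.3] -/
theorem exists_hsComponent_isUnit {g : OriginLocalization k n} {m : ℕ}
    (h1 : g ∈ maximalIdeal (OriginLocalization k n) ^ m)
    (h2 : g ∉ maximalIdeal (OriginLocalization k n) ^ (m + 1)) :
    ∃ β : Fin n →₀ ℕ, degree β = m ∧ IsUnit (hsComponent (taylorHS k n) β g) := by
  classical
  obtain ⟨⟨f, s⟩, hfs⟩ := IsLocalization.mk'_surjective (originIdeal k n).primeCompl g
  have hfs' : IsLocalization.mk' (OriginLocalization k n) f s = g := hfs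
  -- `g = f · u`, `u = 1/s` a unit; `f ∈ 𝔪^m`, `f ∉ (x)^{m+1}`
  have hu_unit : IsUnit (IsLocalization.mk' (OriginLocalization k n) (1 : MvPolynomial (Fin n) k) s) :=
    IsUnit.of_mul_eq_one _ (by
      rw [IsLocalization.mk'_spec (OriginLocalization k n) (1 : MvPolynomial (Fin n) k) s, map_one])
  have hg : g = algebraMap _ (OriginLocalization k n) f * IsLocalization.mk' (OriginLocalization k n) 1 s := by
    rw [← hfs', IsLocalization.mk'_eq_mul_mk'_one f s]
  have hfm : algebraMap _ (OriginLocalization k n) f ∈ maximalIdeal (OriginLocalization k n) ^ m := by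
    have hf : algebraMap _ (OriginLocalization k n) f = g * algebraMap _ (OriginLocalization k n) (s : MvPolynomial (Fin n) k) := by
      rw [← hfs', IsLocalization.mk'_spec]
    rw [hf]
    exact Ideal.mul_mem_right _ _ h1
  have hfm' : f ∉ originIdeal k n ^ (m + 1) := by
    intro hf
    apply h2
    rw [hg]
    exact Ideal.mul_mem_right _ _ ((algebraMap_mem_maximalIdeal_pow_iff k n f (m + 1)).mpr hf)
  -- a monomial of `f` of least degree; its degree is `≤ m` …
  obtain ⟨β₁, hβ₁deg, hβ₁coeff⟩ : ∃ β : Fin n →₀ ℕ, degree β < m + 1 ∧ coeff β f ≠ 0 := by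
    by_contra hne
    push Not at hne
    exact hfm' ((mem_originIdeal_pow_iff k n f (m + 1)).mpr fun β hβ => hne β hβ)
  have hsupp : f.support.Nonempty := ⟨β₁, MvPolynomial.mem_support_iff.mpr hβ₁coeff⟩
  obtain ⟨β, hβsupp, hβmin⟩ := Finset.exists_min_image f.support (fun d => degree d) hsupp
  have hβcoeff : coeff β f ≠ 0 := MvPolynomial.mem_support_iff.mp hβsupp
  have hβle : degree β ≤ m := by
    have := hβmin β₁ (MvPolynomial.mem_support_iff.mpr hβ₁coeff)
    omega
  -- … the value `D^{[β]} f` is a unit (its value at the origin is `coeff_β f ≠ 0`) …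
  have hDf : hsComponent (taylorHS k n) β (algebraMap _ (OriginLocalization k n) f) =
      algebraMap _ (OriginLocalization k n) (Taylor.taylorCoeff β f) := hsComponent_taylorHS_algebraMap k n β f
  have hDf_unit : IsUnit (algebraMap (MvPolynomial (Fin n) k) (OriginLocalization k n) (Taylor.taylorCoeff β f)) := by
    apply IsLocalization.map_units (OriginLocalization k n) (⟨Taylor.taylorCoeff β f, ?_⟩ : (originIdeal k n).primeCompl)
    rw [Ideal.mem_primeCompl_iff, mem_originIdeal_iff, constantCoeff_taylorCoeff]
    exact hβcoeff
  -- … so `|β| = m` (if `|β| < m`, `D^{[β]} f ∈ 𝔪^{m-|β|} ⊆ 𝔪` would be a unit)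
  have hβeq : degree β = m := by
    by_contra hne
    have hlt : degree β < m := lt_of_le_of_ne hβle hne
    have hmem : hsComponent (taylorHS k n) β (algebraMap _ (OriginLocalization k n) f) ∈ maximalIdeal (OriginLocalization k n) :=
      Ideal.pow_le_self (by omega) (hsComponent_taylorHS_mem_pow k n β hfm)
    rw [hDf] at hmem
    exact (IsLocalRing.mem_maximalIdeal _).mp hmem hDf_unit
  refine ⟨β, hβeq, ?_⟩
  -- Leibniz: `D^{[β]}(f u) = D^{[β]}(f)·u + Σ_{δ ≠ 0} D^{[γ]}(f) D^{[δ]}(u)` with the sum in `𝔪`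
  rw [hg, hsComponent_mul]
  have h0 : (β, (0 : Fin n →₀ ℕ)) ∈ Finset.antidiagonal β := by simp
  rw [← Finset.add_sum_erase _ _ h0]
  have hmain : IsUnit (hsComponent (taylorHS k n) β (algebraMap _ (OriginLocalization k n) f) *
      hsComponent (taylorHS k n) 0 (IsLocalization.mk' (OriginLocalization k n) 1 s)) := by
    rw [hsComponent_zero _ (constantCoeff_taylorHS k n), hDf]
    exact hDf_unit.mul hu_unit
  have hrest : ∑ p ∈ (Finset.antidiagonal β).erase (β, 0),
      hsComponent (taylorHS k n) p.1 (algebraMap _ (OriginLocalization k n) f) *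
        hsComponent (taylorHS k n) p.2 (IsLocalization.mk' (OriginLocalization k n) 1 s) ∈ maximalIdeal (OriginLocalization k n) := by
    refine Ideal.sum_mem _ fun p hp => Ideal.mul_mem_right _ _ ?_
    obtain ⟨hne, hp'⟩ := Finset.mem_erase.mp hp
    rw [Finset.mem_antidiagonal] at hp'
    have h2ne : p.2 ≠ 0 := by
      intro h2z
      apply hne
      rw [h2z, add_zero] at hp'
      exact Prod.ext hp' h2z
    have hdeg : degree p.1 + degree p.2 = degree β := by rw [← map_add, hp']
    have h2pos : 1 ≤ degree p.2 := by
      rw [Nat.one_le_iff_ne_zero, Ne, degree_eq_zero_iff]; exact h2ne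
    have hlt : degree p.1 < m := by omega
    exact Ideal.pow_le_self (by omega) (hsComponent_taylorHS_mem_pow k n p.1 hfm)
  -- unit + element of 𝔪 is a unit
  by_contra hnot
  have hmem : _ ∈ maximalIdeal (OriginLocalization k n) := (IsLocalRing.mem_maximalIdeal _).mpr (mem_nonunits_iff.mpr hnot)
  have := (Ideal.add_mem_iff_left _ hrest).mp hmem
  exact (IsLocalRing.mem_maximalIdeal _).mp this hmain

/-- The coefficients of `τ̂(z) mod 𝔪` are the residues of the `D^{[β]} z`. [folklore] -/
private theorem coeff_map_residue_taylorHS (z : OriginLocalization k n) (β : Fin n →₀ ℕ) :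
    MvPowerSeries.coeff β (MvPowerSeries.map (residue (OriginLocalization k n)) (taylorHS k n z)) =
      residue (OriginLocalization k n) (hsComponent (taylorHS k n) β z) := by
  rw [MvPowerSeries.coeff_map]
  rfl

/-- **`τ̂(g) mod 𝔪` has order exactly `ord g`**: for `g ∈ 𝔪^m ∖ 𝔪^{m+1}` the power series
`Σ_β (D^{[β]} g mod 𝔪) Y^β` over the residue field has order `m`. [cite: Matsumura1987, §27] -/
theorem order_map_residue_taylorHS {g : OriginLocalization k n} {m : ℕ}
    (h1 : g ∈ maximalIdeal (OriginLocalization k n) ^ m)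
    (h2 : g ∉ maximalIdeal (OriginLocalization k n) ^ (m + 1)) :
    (MvPowerSeries.map (residue (OriginLocalization k n)) (taylorHS k n g)).order = m := by
  classical
  rw [MvPowerSeries.order_eq_nat]
  constructor
  · obtain ⟨β, hβ, hunit⟩ := exists_hsComponent_isUnit k n h1 h2
    refine ⟨β, ?_, hβ⟩
    rw [coeff_map_residue_taylorHS, Ne, residue_eq_zero_iff]
    exact fun hmem => (IsLocalRing.mem_maximalIdeal _).mp hmem hunit
  · intro β hβ
    rw [coeff_map_residue_taylorHS, residue_eq_zero_iff]
    exact Ideal.pow_le_self (by omega) (hsComponent_taylorHS_mem_pow k n β h1)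

/-- **Powers: `ord(g^e) = e·ord(g)` in unit form.** If `g ∈ 𝔪^m`, `g ∉ 𝔪^{m+1}`, then for every `e`
some `D^{[δ]}(g^e)` with `|δ| = em` is a unit of `S = k[x]_{(x)}` (Taylor homomorphism + the residue
field power series ring is a domain: `MvPowerSeries.order_mul`). [cite: Matsumura1987, §27] -/
theorem exists_hsComponent_pow_isUnit {g : OriginLocalization k n} {m : ℕ}
    (h1 : g ∈ maximalIdeal (OriginLocalization k n) ^ m)
    (h2 : g ∉ maximalIdeal (OriginLocalization k n) ^ (m + 1)) (e : ℕ) :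
    ∃ δ : Fin n →₀ ℕ, degree δ = e * m ∧ IsUnit (hsComponent (taylorHS k n) δ (g ^ e)) := by
  classical
  have hGord := order_map_residue_taylorHS k n h1 h2
  -- `G^e` has order `e m`, `G = τ̂(g) mod 𝔪`
  have hGe : ∀ e : ℕ, ((MvPowerSeries.map (residue (OriginLocalization k n)) (taylorHS k n g)) ^ e).order
      = ((e * m : ℕ) : ℕ∞) := by
    intro e
    induction e with
    | zero =>
      rw [pow_zero, Nat.zero_mul, MvPowerSeries.order_eq_nat]
      refine ⟨⟨0, ?_, by simp⟩, fun d hd => absurd hd (Nat.not_lt_zero _)⟩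
      rw [MvPowerSeries.coeff_zero_one]; exact one_ne_zero
    | succ e ih =>
      rw [pow_succ, MvPowerSeries.order_mul, ih, hGord, Nat.succ_mul, Nat.cast_add]
  have hfin : (((MvPowerSeries.map (residue (OriginLocalization k n)) (taylorHS k n g)) ^ e).order).toNat
      = ((MvPowerSeries.map (residue (OriginLocalization k n)) (taylorHS k n g)) ^ e).order := by
    rw [hGe e, ENat.toNat_coe]
  obtain ⟨δ, hδ, hδdeg⟩ := MvPowerSeries.exists_coeff_ne_zero_and_order hfin
  refine ⟨δ, ?_, ?_⟩
  · rw [hGe e] at hδdeg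
    exact_mod_cast hδdeg
  · rw [← map_pow, ← map_pow, coeff_map_residue_taylorHS, Ne, residue_eq_zero_iff] at hδ
    by_contra hnot
    exact hδ ((IsLocalRing.mem_maximalIdeal _).mpr (mem_nonunits_iff.mpr hnot))

/-- **Unit form of the order criterion at the origin of `𝔸ⁿ_k`, every characteristic**: if
`g ∈ 𝔪^m ∖ 𝔪^{m+1}` in `S = k[x₁,…,xₙ]_{(x)}` then for every `e` some `k`-linear differential operator
of `S` of order `≤ em` takes `g^e` to a unit. [cite: VillamayorU2008ReesDiff, §4.1 and Remark 4.3]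
[cite: EGAIV4, Thm. 16.11.2] -/
theorem exists_isDiffOpLE_isUnit_pow {g : OriginLocalization k n} {m : ℕ}
    (h1 : g ∈ maximalIdeal (OriginLocalization k n) ^ m)
    (h2 : g ∉ maximalIdeal (OriginLocalization k n) ^ (m + 1)) (e : ℕ) :
    ∃ D : OriginLocalization k n →ₗ[k] OriginLocalization k n,
      IsDiffOpLE k (e * m) D ∧ IsUnit (D (g ^ e)) := by
  classical
  obtain ⟨δ, hδ, hunit⟩ := exists_hsComponent_pow_isUnit k n h1 h2 e
  exact ⟨hsOp k n δ, hδ ▸ isDiffOpLE_hsOp k n δ, hunit⟩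

/-- **`Diff^{≤ em}_{S/k}((g^e)) = S`** for `g` of order exactly `m` in `S = k[x]_{(x)}` and every `e`
(the tree's `diffIdeal`). [cite: VillamayorU2008ReesDiff, §4.1 and Remark 4.3] -/
theorem diffIdeal_span_singleton_pow_eq_top {g : OriginLocalization k n} {m : ℕ}
    (h1 : g ∈ maximalIdeal (OriginLocalization k n) ^ m)
    (h2 : g ∉ maximalIdeal (OriginLocalization k n) ^ (m + 1)) (e : ℕ) :
    diffIdeal k (e * m) (Ideal.span {g ^ e}) = ⊤ := by
  obtain ⟨D, hD, hunit⟩ := exists_isDiffOpLE_isUnit_pow k n h1 h2 e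
  exact Ideal.eq_top_of_isUnit_mem _ (apply_mem_diffIdeal k hD (Ideal.mem_span_singleton_self _)) hunit

end OriginLocalization
end Origin
end Literature.AlgebraicGeometry.Resolution
end
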